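import Mathlib
import Summits.ValiantsHypothesis.ValiantsHypothesis.Theorems.GrenetZeonHessianRankCodimTwoBorderAssembly
import Summits.ValiantsHypothesis.ValiantsHypothesis.Theorems.GrenetZeonHessianRankCodimTwoBorderDeathsCharP
import Summits.ValiantsHypothesis.ValiantsHypothesis.Theorems.GrenetZeonHessianRankCodimTwoBorderCertAPIW
import Summits.ValiantsHypothesis.ValiantsHypothesis.Theorems.GrenetZeonHessianRankCodimTwoBorderCertAPIC
import Summits.ValiantsHypothesis.ValiantsHypothesis.Theorems.GrenetZeonHessianRankCodimTwoBorderCertAPIT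
import HarnessLib

/-!
# Crux `GrenetZeon.HessianRankCodimTwo` (stmt-ValiantsHypothesis-8061), line `good_plane`:
# GOOD PLANES FOR ALL LARGE `n` — the closing instantiation (`BorderInterfaces.md` §3)

Everything upstream is in the tree (val-width-8061-p1 g2 LEAD: design, congruences, table identities,
276 Bézout certificates and their API; val-width-8061-p3 g2: prime windows, the characteristic-`p`
death count, the `hK` glue; this seat: the assembly `bordCoreNonvanishing_of_deaths`).  This file
plugs the certificate API (`bord_wline_*`, `bord_classpt_Q/E`, `bord_triple`) into the death count
(`bord_deaths_le_four`) inside the assembly: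

* `bordCoreNonvanishing_of_large_prime` — `(★★)` `BordCoreNonvanishing p r` for every prime
  `p ≥ 3·10¹⁴` and every `1 ≤ r ≤ p - 3` (the arithmetic hypothesis `hK` of the certificates holds in
  characteristic `p ≥ 3·10¹⁴`, `natCast_ne_zero_of_lt_of_charP`);
* `goodPlanes_all_large` — **`∃ n₀, ∀ n ≥ n₀, GoodPlane n`** (the registered stub `stub_goodPlanes` of
  `Cruxes/HessianRankCodimTwo/Lines/good_plane.lean`, unfolded definitionally), by p3's
  `goodPlanes_of_bordCoreNonvanishing'` (`n = 3p + r` with a prime `p ∈ (n/3.15, n/3]` from the PNT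
  window; `r = 0` is Theorem P);
* `hessianRankCodimTwo_all_large` — the crux body for all large `n`, via the landed plane criterion
  (`…PlaneCriterion.lean`), i.e. `HessianRankCodimTwo` itself with its definition unfolded.

The sorry-free skeleton (`stub_goodPlanes := goodPlanes_all_large`) is filed by the lead
`--workitem stmt-ValiantsHypothesis-8061`.  HONEST FRAMING: this closes a crux about the GEOMETRY OF THE
PERMANENTAL HYPERSURFACE (every hypersurface section of `Z(per_n)` meets the locus where the Hessian of
`per_n` has rank `> n²/2`, `n` large); downstream it feeds only the constant-factor bound
`TwoDimCoefficients`.  VP ≠ VNP is NOT moved.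
-/

noncomputable section

open MvPolynomial Finset
open Literature.Computability.AlgebraicComplexity

-- single-conjunct layout `Summits/ValiantsHypothesis/ValiantsHypothesis`: duplicated namespace by design
set_option linter.dupNamespace false

namespace Summit.ValiantsHypothesis.ValiantsHypothesis.Theorems.GrenetZeonHessianRankCodimTwo

/-- **`(★★)` for all large primes.** For every prime `p ≥ 3·10¹⁴` and `1 ≤ r ≤ p - 3`: at every point of
the bordered Latin plane of size `3p + r` on the permanental hypersurface, at least five of the nine
core block values are non-zero. [folklore] -/
theorem bordCoreNonvanishing_of_large_prime {p r : ℕ} (hp : p.Prime)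
    (hB : 300000000000000 ≤ p) (hr1 : 1 ≤ r) (hr : r + 3 ≤ p) : BordCoreNonvanishing p r :=
  bordCoreNonvanishing_of_deaths hp hr1 hr fun L _ _ _ c hc x hx hcurve => by
    have hK := natCast_ne_zero_of_lt_of_charP L p hB
    exact bord_deaths_le_four hK
      (fun x hx hw _ _ hd hd' => bord_wline_class_class hK x hx hw hd hd')
      (fun x hx hw _ _ hd hI => bord_wline_class_row hK x hx hw hd hI)
      (fun x hx hw _ _ hd hJ => bord_wline_class_col hK x hx hw hd hJ)
      (fun x hx hw _ _ hI hI' => bord_wline_row_row hK x hx hw hI hI')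
      (fun x hx hw _ _ hJ hJ' => bord_wline_col_col hK x hx hw hJ hJ')
      (fun x hx hw _ _ hI hJ => bord_wline_row_col hK x hx hw hI hJ)
      (fun x hx hF _ hd₀ _ _ hIJ => bord_classpt_Q hK x hx hF hd₀ hIJ)
      (fun x hx hF _ hd₀ _ _ _ _ hIJ hIJ' hne hU hU' hxd hxd' =>
        bord_classpt_E hK x hx hF hd₀ hIJ hIJ' hne hU hU' hxd hxd')
      (fun x _ hF _ hall _ _ _ _ _ _ h12 h13 h23 hU₁ hU₂ hU₃ r12 r13 =>
        bord_triple hK x hF hall h12 h13 h23 hU₁ hU₂ hU₃ r12 r13)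
      c hc x hx hcurve

/-- **GOOD PLANES FOR ALL LARGE `n`** — the registered stub `stub_goodPlanes` of `Lines/good_plane.lean`,
with `GoodPlane` / `HalfRankExceeded` unfolded: for every large `n` there are three linearly independent
`n × n` matrices on whose span every non-zero zero of `per_n` has `rank Hess per_n > n²/2`. [folklore] -/
theorem goodPlanes_all_large :
    ∃ n₀ : ℕ, ∀ n ≥ n₀,
      ∃ w : Fin 3 → (Fin n × Fin n → ℂ), LinearIndependent ℂ w ∧
        ∀ a : Fin 3 → ℂ, a ≠ 0 →
          MvPolynomial.eval (∑ i, a i • w i) (perPoly (Fin n) ℂ) = 0 →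
            n ^ 2 < 2 * (hess0 (transl (∑ i, a i • w i) (perPoly (Fin n) ℂ))).rank :=
  goodPlanes_of_bordCoreNonvanishing'
    ⟨300000000000000, fun _ hp hprime _ hr1 hr => bordCoreNonvanishing_of_large_prime hprime hp hr1 hr⟩

/-- **The crux body for all large `n`.** For every large `n` and every polynomial `g`, if `Z(per_n) ∩ Z(g)`
is non-empty then it contains a point where the Hessian of `per_n` has rank `> n²/2` — i.e.
`HessianRankCodimTwo` (route `GrenetZeon`) with its definition unfolded; from `goodPlanes_all_large` and
the landed plane criterion `planeCriterion`. [folklore] -/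
theorem hessianRankCodimTwo_all_large :
    ∃ n₀ : ℕ, ∀ n ≥ n₀, ∀ g : MvPolynomial (Fin n × Fin n) ℂ,
      (∃ q : Fin n × Fin n → ℂ, MvPolynomial.eval q (perPoly (Fin n) ℂ) = 0 ∧ MvPolynomial.eval q g = 0) →
      ∃ q : Fin n × Fin n → ℂ, MvPolynomial.eval q (perPoly (Fin n) ℂ) = 0 ∧ MvPolynomial.eval q g = 0 ∧
        n ^ 2 < 2 * (hess0 (transl q (perPoly (Fin n) ℂ))).rank := by
  obtain ⟨n₀, hgood⟩ := goodPlanes_all_large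
  exact ⟨n₀, fun n hn g hg =>
    Summit.ValiantsHypothesis.ValiantsHypothesis.Theorems.GrenetZeon.HessianRankCodimTwo.planeCriterion
      n (hgood n hn) g hg⟩

end Summit.ValiantsHypothesis.ValiantsHypothesis.Theorems.GrenetZeonHessianRankCodimTwo
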